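import Literature.AlgebraicGeometry.ShimuraVarieties.UnitaryShimuraCurveRecord
import Literature.AlgebraicGeometry.ShimuraVarieties.UnitaryConeDiscontinuity
import HarnessLib

/-!
# The levels of a unitary Shimura-curve record are torsion free for the Shimura datum

Topic `Literature/AlgebraicGeometry/ShimuraVarieties`, namespace
`Literature.AlgebraicGeometry.ShimuraVarieties.UnitaryCanonicalModel`.  Cell `hodgecm-mathlib` (D-0151), FLOOR 0, sub-line
`Cruxes/HLiu418/Lines/F0-D9opRoad2` (crux item stmt-HodgeConjecture-24832), ED. 5.1 letter interface `RecordLevelTorsionFree`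
(F0P5a-plan (g3) desk v0.3; F0P5a-ref1 (g0) OBJECTION #2, 2026-08-31): the torsion hypothesis charged to the MOD letter is
REDUNDANT in record currency.  THEOREMS ONLY (no definition, no named fact, no instance).

THE PRINT.  [Deligne1979ShimuraVarieties] 2.1.2: «`_K M_ℂ(G, X)` is a disjoint sum, indexed by `G(ℚ)\G(𝔸^f)/K`, of the
quotients `Γ_g \ X⁺`, `Γ_g = gKg⁻¹ ∩ G(ℚ)`»; [Milne2005ShimuraVarieties] Lemma 5.13 p. 57 (the same double-coset dissection,
`Γ_g = gKg⁻¹ ∩ G(ℚ)`) and Prop. 3.5 ∕ §3 pp. 33–34 («neat», torsion-free arithmetic groups).  In the tree the rank-2 record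
★ `UnitaryCanonicalModel.RecordSystemGS` carries this as clause (F2c) `pieces`: at every small level `K` there are
representatives `g_q` of `U(J⋆)(L⁺) \ U(J⋆)(𝔸_f) / K` (surjectivity `⟦g_q K⟧ = q`) and ball-uniformisation data `B q` with
`(B q).Γ^{τ₁} = Γ_{J⋆}(g_q K g_q⁻¹)^τ` (★ `arithmeticLevel`) — and EVERY ★ `UnitaryBallUniformisationDatum` has the field
`torsionFree : ∀ γ ∈ Γ, IsOfFinOrder γ → γ = 1`.

WHAT IS PROVED.  For a record `S : RecordSystemGS L J⋆ τ K₀` and ANY small level `Kc ≤ K₀`: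
* `RecordSystemGS.eq_one_of_isOfFinOrder_of_conj_mem` — every rational `g ∈ U(J⋆)(L⁺)` of finite order with
  `a⁻¹ g a ∈ Kc` for some finite-adelic `a` is `1`.  This is, token for token, the body of the ED. 5.1 letter
  `RecordLevelTorsionFree F Jstar Kc.1.1` of the D9op desk — for EVERY small level, with NO congruence hypothesis on `Kc`
  (the Minkowski road ★ `UnitaryGroup.torsionFree_arithmeticLevel_map_conj` needs `Kc ≤ K(𝔫)`, `3 ≤ 𝔫`).
  Proof (ref1's sketch): write `g_q = γ′ a k` (`γ′` rational, `k ∈ Kc`) from `⟦g_q Kc⟧ = ⟦a Kc⟧`; then `h = γ′ g γ′⁻¹` lies in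
  `Γ_{J⋆}(g_q Kc g_q⁻¹)`, so `h^τ = γ^{τ₁}` for some `γ ∈ (B q).Γ`; finite order passes through the injective `GL₂(τ)`,
  `GL₂(τ₁)`; `(B q).torsionFree` gives `γ = 1`, hence `h = 1`, hence `g = 1`.
* `RecordSystemGS.eq_one_of_conj_mem_of_smul_mulVec_eq` — the LINE-FREENESS sibling consumed by the ED. 5.2 letter FULL
  (`RecordNeatLevelFullFibres`, row (b12), F0P5a-p02 (g3)): a rational `γ` with `a⁻¹ γ a ∈ Kc` fixing a negative line `ℂ v` of `J⋆^τ`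
  (`c · γ^τ v = v`) is `1` — the same (F2c) transport, closed by ★ `UnitaryBallUniformisationDatum.eq_one_of_act_eq_smul`
  (★ `UnitaryConeDiscontinuity` §5) instead of `torsionFree`.
* `RecordSystemGS.torsionFree_arithmeticLevel_map_conj` — the same in ★ `arithmeticLevel` currency: every conjugate level
  group `Γ_{J⋆}(a Kc a⁻¹)` is torsion free; `RecordSystemGS.torsionFree_arithmeticLevel` — the case `a = 1`;
  `RecordSystemGS.torsionFree_arithmeticLevel_map_conj_top` — at `Kc = K₀`: VERBATIM the torsion hypothesis of the named fact
  ★ `UnitaryCanonicalModel.exists_recordSystemGS`, which is therefore NECESSARY (tightness of the named fact; inhabitation audits);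
  `RecordSystemGS.rationalToFinAdelic_notMem_of_sq_eq_one` — no record below a `K₀` containing a rational involution such as `-1`.
HC_CM is proved only modulo the printed citations until rung 0 closes; this file discharges no named fact.
-/

set_option autoImplicit false

noncomputable section

open Function MulAction NumberField Matrix
open Literature.AlgebraicGeometry.Motives (SchemeOver)
open Literature.NumberTheory.Automorphic Literature.NumberTheory.Automorphic.UnitaryGroup
open Literature.NumberTheory.Automorphic.ShimuraDissection
open Literature.NumberTheory.Automorphic.Liu2021.AppendixC (C5.OpenCompactSubgroup C5.SmallLevel)

namespace Literature.AlgebraicGeometry.ShimuraVarieties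

namespace UnitaryCanonicalModel

variable {L : Type} [Field L] [NumberField L] [IsCMField L] {Jstar : Matrix (Fin 2) (Fin 2) L} {τ : L →+* ℂ}
variable {K₀ : C5.OpenCompactSubgroup ↥(finAdelic (↥(maximalRealSubfield L)) L (IsCMField.complexConj L) 2 Jstar)}

/-- `GL_n` of an injective ring homomorphism is injective (entrywise). [folklore] -/
private theorem glMap_injective {R S : Type*} [CommRing R] [CommRing S] {m : Type*} [Fintype m] [DecidableEq m]
    {f : R →+* S} (hf : Injective f) : Injective (Matrix.GeneralLinearGroup.map (n := m) f) := fun x y h =>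
  Matrix.GeneralLinearGroup.ext fun i j => hf (by
    have := congrArg (fun g : GL m S => (g : Matrix m m S) i j) h
    simpa only [Matrix.GeneralLinearGroup.map_apply] using this)

/-- (F2c) UNPACKED AT ONE ELEMENT.  For `a⁻¹ g a ∈ Kc` (`g` rational, `a` finite-adelic): the double coset `q = ⟦a Kc⟧` has the
record's representative `g_q = γ′ a k` (`γ′` rational, `k ∈ Kc`), so `γ′ g γ′⁻¹ ∈ Γ_{J⋆}(g_q Kc g_q⁻¹)`, whose `τ`-image is the
`τ₁`-image of an element `δ` of the ball group `(B q).Γ` of the piece `X q` — with `(B q).Hℂ = J⋆^τ`. [folklore] -/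
private theorem RecordSystemGS.exists_piece_of_conj_mem (S : RecordSystemGS L Jstar τ K₀) (Kc : C5.SmallLevel K₀)
    (g : ↥(rational ↥(maximalRealSubfield L) L (IsCMField.complexConj L) 2 Jstar))
    (a : ↥(finAdelic ↥(maximalRealSubfield L) L (IsCMField.complexConj L) 2 Jstar))
    (ha : a⁻¹ * rationalToFinAdelic ↥(maximalRealSubfield L) L (IsCMField.complexConj L) 2 Jstar g * a ∈ Kc.1.1) :
    ∃ (X : SchemeOver ℂ) (D : UnitaryBallUniformisationDatum 1 X)
      (γ' : ↥(rational ↥(maximalRealSubfield L) L (IsCMField.complexConj L) 2 Jstar)) (δ : GL (Fin (1 + 1)) ↥D.E),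
      δ ∈ D.Γ ∧ D.Hℂ = Jstar.map τ ∧
        Matrix.GeneralLinearGroup.map (D.τ₁ : ↥D.E →+* ℂ) δ =
          Matrix.GeneralLinearGroup.map τ
            ((MulAut.conj γ' g : ↥(rational ↥(maximalRealSubfield L) L (IsCMField.complexConj L) 2 Jstar)) : GL (Fin 2) L) := by
  letI : Algebra L ℂ := τ.toAlgebra
  have hP := S.pieces Kc
  obtain ⟨gq, hgq, X, ιX, -, B, hB⟩ := hP
  -- the double coset `q` of `a Kc`, its representative `b := g_q` and its ball datum `D := B q`
  obtain ⟨q, hqa⟩ : ∃ q : orbitRel.Quotient ↥(rational ↥(maximalRealSubfield L) L (IsCMField.complexConj L) 2 Jstar)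
      (CosetSpace (rationalToFinAdelic ↥(maximalRealSubfield L) L (IsCMField.complexConj L) 2 Jstar) Kc.1.1),
      q = Quotient.mk'' (CosetSpace.pt (rationalToFinAdelic _ L _ 2 Jstar) Kc.1.1 a) := ⟨_, rfl⟩
  have hΓ := (hB q).2.1
  have hH := (hB q).1
  have hq := hgq q
  clear hB hgq
  obtain ⟨b, hb⟩ : ∃ b : ↥(finAdelic ↥(maximalRealSubfield L) L (IsCMField.complexConj L) 2 Jstar), gq q = b := ⟨_, rfl⟩
  obtain ⟨D, hD⟩ : ∃ D : UnitaryBallUniformisationDatum 1 (X q), B q = D := ⟨_, rfl⟩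
  rw [hb] at hΓ hq
  rw [hD] at hΓ hH
  clear hb hD B gq
  -- `⟦b Kc⟧ = ⟦a Kc⟧`: `b = γ′ a k` with `γ′` rational and `k := (γ′ a)⁻¹ b ∈ Kc`
  rw [hqa] at hq
  obtain ⟨γ', hγ'⟩ := mem_orbit_iff.mp (Quotient.eq''.mp hq)
  rw [CosetSpace.smul_pt, CosetSpace.pt_eq_pt_iff] at hγ'
  have hb_eq : b = rationalToFinAdelic _ L _ 2 Jstar γ' * a * ((rationalToFinAdelic _ L _ 2 Jstar γ' * a)⁻¹ * b) := by
    rw [mul_inv_cancel_left]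
  -- `γ′ g γ′⁻¹` is rational with `b⁻¹ (γ′ g γ′⁻¹) b ∈ Kc`
  have hmem : b⁻¹ * rationalToFinAdelic _ L _ 2 Jstar (MulAut.conj γ' g) * b ∈ Kc.1.1 := by
    have hcalc : b⁻¹ * rationalToFinAdelic _ L _ 2 Jstar (MulAut.conj γ' g) * b =
        ((rationalToFinAdelic _ L _ 2 Jstar γ' * a)⁻¹ * b)⁻¹ * (a⁻¹ * rationalToFinAdelic _ L _ 2 Jstar g * a) *
          ((rationalToFinAdelic _ L _ 2 Jstar γ' * a)⁻¹ * b) := by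
      conv_lhs => rw [hb_eq]
      rw [MulAut.conj_apply, map_mul, map_mul, map_inv]
      group
    rw [hcalc]
    exact Kc.1.1.mul_mem (Kc.1.1.mul_mem (Kc.1.1.inv_mem hγ') ha) hγ'
  -- hence `γ′ g γ′⁻¹ ∈ Γ_{J⋆}(b Kc b⁻¹)`
  have harith : ((MulAut.conj γ' g : ↥(rational ↥(maximalRealSubfield L) L (IsCMField.complexConj L) 2 Jstar)) :
        GL (Fin 2) L) ∈
      arithmeticLevel ↥(maximalRealSubfield L) L (IsCMField.complexConj L) 2 Jstar
        (Kc.1.1.map (MulAut.conj b).toMonoidHom) := by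
    refine mem_arithmeticLevel_iff.mpr ⟨(MulAut.conj γ' g).2, ?_⟩
    rw [Subgroup.mem_map_equiv, MulAut.conj_symm_apply]
    exact hmem
  -- read it in `D.Γ` through `τ` and `τ₁`
  have hmapped : Matrix.GeneralLinearGroup.map τ
      ((MulAut.conj γ' g : ↥(rational ↥(maximalRealSubfield L) L (IsCMField.complexConj L) 2 Jstar)) : GL (Fin 2) L) ∈
      D.Γ.map (Matrix.GeneralLinearGroup.map (D.τ₁ : ↥D.E →+* ℂ)) := by
    rw [hΓ]
    exact Subgroup.mem_map_of_mem _ harith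
  obtain ⟨δ, hδΓ, hδeq⟩ := Subgroup.mem_map.mp hmapped
  exact ⟨X q, D, γ', δ, hδΓ, hH, hδeq⟩

/-- If `(γ′ g γ′⁻¹)^τ = 1` in `GL₂(ℂ)` then `g = 1` (`τ` is injective). [folklore] -/
private theorem eq_one_of_map_coe_conj_eq_one {g γ' : ↥(rational ↥(maximalRealSubfield L) L (IsCMField.complexConj L) 2 Jstar)}
    (h : Matrix.GeneralLinearGroup.map τ
      ((MulAut.conj γ' g : ↥(rational ↥(maximalRealSubfield L) L (IsCMField.complexConj L) 2 Jstar)) : GL (Fin 2) L) = 1) :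
    g = 1 := by
  have hGL : ((MulAut.conj γ' g : ↥(rational ↥(maximalRealSubfield L) L (IsCMField.complexConj L) 2 Jstar)) :
      GL (Fin 2) L) = 1 :=
    glMap_injective τ.injective (by rw [h, map_one])
  exact (MulEquiv.map_eq_one_iff (MulAut.conj γ')).mp (Subtype.ext hGL)

/-- **Record levels are torsion free for the Shimura datum** ([Deligne1979ShimuraVarieties] 2.1.2 pieces
`Γ_g = gKg⁻¹ ∩ G(ℚ)` + torsion-freeness of the ball-quotient groups): for a rank-2 unitary Shimura-curve record `S` and ANY
small level `Kc`, a rational element `g ∈ U(J⋆)(L⁺)` of finite order lying adelically in a conjugate `a Kc a⁻¹` is trivial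
(central roots of unity included).  Token for token the (struck) ED. 5.1 desk letter `RecordLevelTorsionFree L Jstar Kc.1.1`.
[cite: Deligne1979ShimuraVarieties, 2.1.2] [cite: Milne2005ShimuraVarieties, Lemma 5.13 p. 57; Prop. 3.5 pp. 33–34] -/
theorem RecordSystemGS.eq_one_of_isOfFinOrder_of_conj_mem (S : RecordSystemGS L Jstar τ K₀) (Kc : C5.SmallLevel K₀) :
    ∀ (g : ↥(rational ↥(maximalRealSubfield L) L (IsCMField.complexConj L) 2 Jstar))
      (a : ↥(finAdelic ↥(maximalRealSubfield L) L (IsCMField.complexConj L) 2 Jstar)),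
      a⁻¹ * rationalToFinAdelic ↥(maximalRealSubfield L) L (IsCMField.complexConj L) 2 Jstar g * a ∈ Kc.1.1 →
        IsOfFinOrder g → g = 1 := by
  intro g a ha hfin
  obtain ⟨X, D, γ', δ, hδΓ, -, hδeq⟩ := S.exists_piece_of_conj_mem Kc g a ha
  -- finite order passes to `δ` through the injective `GL₂(τ)`, `GL₂(τ₁)` (on powers)
  obtain ⟨n, hn, hgn⟩ := (isOfFinOrder_iff_pow_eq_one).mp hfin
  have hxn : ((MulAut.conj γ' g : ↥(rational ↥(maximalRealSubfield L) L (IsCMField.complexConj L) 2 Jstar)) :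
      GL (Fin 2) L) ^ n = 1 := by
    rw [← Subgroup.coe_pow, ← map_pow, hgn, map_one, Subgroup.coe_one]
  have hδn : δ ^ n = 1 := by
    apply glMap_injective (RingHom.injective (D.τ₁ : ↥D.E →+* ℂ))
    rw [map_pow, hδeq, ← map_pow, hxn, map_one, map_one]
  have hδ1 : δ = 1 := D.torsionFree δ hδΓ ((isOfFinOrder_iff_pow_eq_one).mpr ⟨n, hn, hδn⟩)
  exact eq_one_of_map_coe_conj_eq_one (by rw [← hδeq, hδ1, map_one])

/-- **Record levels act freely on the negative LINES** (the line-freeness sibling of the previous theorem, consumed by the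
ED. 5.2 letter `RecordNeatLevelFullFibres`, F0P5a-p02 (g3) row (b12)): for a record `S`, ANY small level `Kc`, a rational
`γ ∈ U(J⋆)(L⁺)` lying adelically in a conjugate `a Kc a⁻¹` and fixing the negative line `ℂ v` of `J⋆^τ` (`c · γ^τ v = v`) is
trivial — (F2c) transports `γ′ γ γ′⁻¹` into the ball group `(B q).Γ` of a piece, where ★
`UnitaryBallUniformisationDatum.eq_one_of_act_eq_smul` (a line-fixing element has bounded powers, hence finite order, hence is
`1` by `torsionFree`) applies at `v₀ = γ′^τ v`.
[cite: Deligne1979ShimuraVarieties, 2.1.2] [cite: Milne2005ShimuraVarieties, Lemma 5.13 p. 57; Prop. 3.1 (b) p. 32] -/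
theorem RecordSystemGS.eq_one_of_conj_mem_of_smul_mulVec_eq (S : RecordSystemGS L Jstar τ K₀) (Kc : C5.SmallLevel K₀)
    (γ : ↥(rational ↥(maximalRealSubfield L) L (IsCMField.complexConj L) 2 Jstar))
    (a : ↥(finAdelic ↥(maximalRealSubfield L) L (IsCMField.complexConj L) 2 Jstar))
    (ha : a⁻¹ * rationalToFinAdelic ↥(maximalRealSubfield L) L (IsCMField.complexConj L) 2 Jstar γ * a ∈ Kc.1.1)
    {v : Fin 2 → ℂ} (hv : v ∈ negCone (Jstar.map τ)) {c : ℂ}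
    (h : c • ((((ratToGLℂ L Jstar τ γ : GL (Fin 2) ℂ)) : Matrix (Fin 2) (Fin 2) ℂ) *ᵥ v) = v) : γ = 1 := by
  obtain ⟨X, D, γ', δ, hδΓ, hH, hδeq⟩ := S.exists_piece_of_conj_mem Kc γ a ha
  -- `c ≠ 0` (the cone misses `0`) and `γ^τ v = c⁻¹ v`
  have hc : c ≠ 0 := by
    rintro rfl
    rw [zero_smul] at h
    rw [← h] at hv
    have h0 := mem_negCone_iff.1 hv
    simp at h0
  have hγv : (((ratToGLℂ L Jstar τ γ : GL (Fin 2) ℂ)) : Matrix (Fin 2) (Fin 2) ℂ) *ᵥ v = c⁻¹ • v := by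
    rw [eq_inv_smul_iff₀ hc, h]
  -- `v₀ := γ′^τ v` lies in the cone of the piece (`D.Hℂ = J⋆^τ`)
  have hv₀ : (((ratToGLℂ L Jstar τ γ' : GL (Fin 2) ℂ)) : Matrix (Fin 2) (Fin 2) ℂ) *ᵥ v ∈ D.cone := by
    have h1 := smul_ratToGLℂ_mulVec_mem_negCone L Jstar τ γ' one_ne_zero hv
    rw [one_smul] at h1
    show _ ∈ negCone D.Hℂ
    rw [hH]
    exact h1
  -- `δ^{τ₁} = (γ′ γ γ′⁻¹)^τ` acts on `v₀` by `c⁻¹`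
  have hmat : (((δ : GL (Fin (1 + 1)) ↥D.E) : Matrix (Fin (1 + 1)) (Fin (1 + 1)) ↥D.E).map (D.τ₁ : ↥D.E →+* ℂ)) =
      (((ratToGLℂ L Jstar τ (MulAut.conj γ' γ) : GL (Fin 2) ℂ)) : Matrix (Fin 2) (Fin 2) ℂ) :=
    congrArg (fun u : GL (Fin (1 + 1)) ℂ => (u : Matrix (Fin (1 + 1)) (Fin (1 + 1)) ℂ)) hδeq
  have hGL : ratToGLℂ L Jstar τ (MulAut.conj γ' γ) * ratToGLℂ L Jstar τ γ' =
      ratToGLℂ L Jstar τ γ' * ratToGLℂ L Jstar τ γ := by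
    rw [← map_mul, ← map_mul, MulAut.conj_apply, inv_mul_cancel_right]
  have hact : D.act δ ((((ratToGLℂ L Jstar τ γ' : GL (Fin 2) ℂ)) : Matrix (Fin 2) (Fin 2) ℂ) *ᵥ v) =
      c⁻¹ • ((((ratToGLℂ L Jstar τ γ' : GL (Fin 2) ℂ)) : Matrix (Fin 2) (Fin 2) ℂ) *ᵥ v) := by
    show (((δ : GL (Fin (1 + 1)) ↥D.E) : Matrix (Fin (1 + 1)) (Fin (1 + 1)) ↥D.E).map (D.τ₁ : ↥D.E →+* ℂ)) *ᵥ
        ((((ratToGLℂ L Jstar τ γ' : GL (Fin 2) ℂ)) : Matrix (Fin 2) (Fin 2) ℂ) *ᵥ v) = _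
    rw [hmat, mulVec_mulVec, ← Units.val_mul, hGL, Units.val_mul, ← mulVec_mulVec, hγv, mulVec_smul]
  have hδ1 : (⟨δ, hδΓ⟩ : ↥D.Γ) = 1 := D.eq_one_of_act_eq_smul (γ := ⟨δ, hδΓ⟩) hv₀ hact
  have hδ1' : δ = 1 := OneMemClass.coe_eq_one.mpr hδ1
  exact eq_one_of_map_coe_conj_eq_one (by rw [← hδeq, hδ1', map_one])

/-- **Every conjugate level group `Γ_{J⋆}(a Kc a⁻¹)` of a record level is torsion free** — the same statement in
★ `arithmeticLevel` currency (the shape of the datum field ★ `UnitaryBallUniformisationDatum.torsionFree` and of the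
Minkowski road ★ `UnitaryGroup.torsionFree_arithmeticLevel_map_conj`, here for EVERY small level of a record).
[cite: Deligne1979ShimuraVarieties, 2.1.2] [cite: Milne2005ShimuraVarieties, Lemma 5.13 p. 57] -/
theorem RecordSystemGS.torsionFree_arithmeticLevel_map_conj (S : RecordSystemGS L Jstar τ K₀) (Kc : C5.SmallLevel K₀)
    (a : ↥(finAdelic ↥(maximalRealSubfield L) L (IsCMField.complexConj L) 2 Jstar)) :
    ∀ γ ∈ arithmeticLevel ↥(maximalRealSubfield L) L (IsCMField.complexConj L) 2 Jstar
        (Kc.1.1.map (MulAut.conj a).toMonoidHom),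
      IsOfFinOrder γ → γ = 1 := by
  intro γ hγ hfin
  obtain ⟨hγrat, hγK⟩ := mem_arithmeticLevel_iff.mp hγ
  rw [Subgroup.mem_map_equiv, MulAut.conj_symm_apply] at hγK
  obtain ⟨n, hn, hγn⟩ := (isOfFinOrder_iff_pow_eq_one).mp hfin
  have hfin' : IsOfFinOrder (⟨γ, hγrat⟩ : ↥(rational ↥(maximalRealSubfield L) L (IsCMField.complexConj L) 2 Jstar)) :=
    (isOfFinOrder_iff_pow_eq_one).mpr ⟨n, hn, Subtype.ext (by rw [Subgroup.coe_pow, Subgroup.coe_one]; exact hγn)⟩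
  have := S.eq_one_of_isOfFinOrder_of_conj_mem Kc ⟨γ, hγrat⟩ a hγK hfin'
  exact congrArg Subtype.val this

/-- **In particular the level group `Γ_{J⋆}(Kc)` itself is torsion free** (`a = 1`).
[cite: Deligne1979ShimuraVarieties, 2.1.2] [cite: Milne2005ShimuraVarieties, Lemma 5.13 p. 57] -/
theorem RecordSystemGS.torsionFree_arithmeticLevel (S : RecordSystemGS L Jstar τ K₀) (Kc : C5.SmallLevel K₀) :
    ∀ γ ∈ arithmeticLevel ↥(maximalRealSubfield L) L (IsCMField.complexConj L) 2 Jstar Kc.1.1,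
      IsOfFinOrder γ → γ = 1 := by
  intro γ hγ hfin
  obtain ⟨hγrat, hγK⟩ := mem_arithmeticLevel_iff.mp hγ
  obtain ⟨n, hn, hγn⟩ := (isOfFinOrder_iff_pow_eq_one).mp hfin
  have hfin' : IsOfFinOrder (⟨γ, hγrat⟩ : ↥(rational ↥(maximalRealSubfield L) L (IsCMField.complexConj L) 2 Jstar)) :=
    (isOfFinOrder_iff_pow_eq_one).mpr ⟨n, hn, Subtype.ext (by rw [Subgroup.coe_pow, Subgroup.coe_one]; exact hγn)⟩
  have := S.eq_one_of_isOfFinOrder_of_conj_mem Kc ⟨γ, hγrat⟩ 1 (by rwa [inv_one, one_mul, mul_one]) hfin'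
  exact congrArg Subtype.val this

/-- **The torsion clause of ★ `exists_recordSystemGS` is NECESSARY**: a record system on the levels below `K₀` exists only if
EVERY conjugate arithmetic level `U(J⋆)(L⁺) ∩ g K₀ g⁻¹` is torsion free — verbatim the hypothesis
`∀ g, ∀ γ ∈ arithmeticLevel … (K₀.1.map (MulAut.conj g).toMonoidHom), IsOfFinOrder γ → γ = 1` under which the named fact
★ `UnitaryCanonicalModel.exists_recordSystemGS` ([Deligne1979ShimuraVarieties] 2.2.5 + Cor. 2.7.21) posits `S`.  In particular
`RecordSystemGS L J⋆ τ K₀` is EMPTY whenever `-1 ∈ K₀` or, more generally, some `g K₀ g⁻¹` meets a non-trivial rational element of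
finite order (inhabitation audits: choose `K₀` inside a principal congruence level `K(𝔫)`, `3 ≤ 𝔫`, ★
`UnitaryGroup.torsionFree_arithmeticLevel_map_conj`).
[cite: Deligne1979ShimuraVarieties, 2.1.2 and 2.2.5] [cite: Milne2005ShimuraVarieties, Lemma 5.13 p. 57; Prop. 3.5 pp. 33–34] -/
theorem RecordSystemGS.torsionFree_arithmeticLevel_map_conj_top (S : RecordSystemGS L Jstar τ K₀) :
    ∀ g : ↥(finAdelic ↥(maximalRealSubfield L) L (IsCMField.complexConj L) 2 Jstar),
      ∀ γ ∈ arithmeticLevel ↥(maximalRealSubfield L) L (IsCMField.complexConj L) 2 Jstar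
          (K₀.1.map (MulAut.conj g).toMonoidHom),
        IsOfFinOrder γ → γ = 1 :=
  fun g => S.torsionFree_arithmeticLevel_map_conj ⟨K₀, le_rfl⟩ g

/-- **No record below a level containing a rational involution** (e.g. the central scalar `-1 ∈ U(J⋆)(L⁺)`, of order `2`):
a `RecordSystemGS L J⋆ τ K₀` forces `g ∉ K₀` (read in `U(J⋆)(𝔸_{L⁺,f})`) for every rational `g ≠ 1` with `g² = 1` — the smallness of
`K₀` in ★ `exists_recordSystemGS` is not decoration. [cite: Deligne1979ShimuraVarieties, 2.1.2] [cite: Milne2005ShimuraVarieties, Prop. 3.5 pp. 33–34] -/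
theorem RecordSystemGS.rationalToFinAdelic_notMem_of_sq_eq_one (S : RecordSystemGS L Jstar τ K₀)
    (g : ↥(rational ↥(maximalRealSubfield L) L (IsCMField.complexConj L) 2 Jstar)) (hg : g ≠ 1) (hg2 : g ^ 2 = 1) :
    rationalToFinAdelic ↥(maximalRealSubfield L) L (IsCMField.complexConj L) 2 Jstar g ∉ K₀.1 := by
  intro hmem
  refine hg (S.eq_one_of_isOfFinOrder_of_conj_mem ⟨K₀, le_rfl⟩ g 1 (by rwa [inv_one, one_mul, mul_one]) ?_)
  exact (isOfFinOrder_iff_pow_eq_one).mpr ⟨2, two_pos, hg2⟩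

/-! ### EDITION 2 (A-p11 (g16), 2026-08-31): freeness on the complex Shimura set `Sh_N(ℂ)` -/

/-- **A record level `Kc` acts FREELY on `Sh_N(ℂ)` modulo `N`** (`N ≤ Kc` small levels of a record `S`): if right translation
by `k ∈ Kc` fixes the point `[v, aN]` of `Sh_N(U(J⋆), 𝔻)(ℂ)` then `k ∈ N`.  By ★ `ShimuraSetGS.mk_eq_mk_iff` a fixed point gives a
rational `γ` fixing the negative line `ℂ v` with `γ a N = a k N`, so `a⁻¹ γ a ∈ k N ⊆ Kc` and `γ = 1` by
`eq_one_of_conj_mem_of_smul_mulVec_eq`, whence `k ∈ N`.  This is the group-theoretic core of «neat levels give étale level maps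
with full fibres» ([Milne2005ShimuraVarieties] Prop. 3.1 (b), Rem. 5.29 (c); [Deligne1979ShimuraVarieties] 2.1.2, 2.7.1) for the
rank-2 record, with NO neatness hypothesis beyond the record itself (row (b12) ∕ letter `RecordNeatLevelFullFibres` of the
D9op line, (R1) core).
[cite: Deligne1979ShimuraVarieties, 2.1.2] [cite: Milne2005ShimuraVarieties, Lemma 5.13 p. 57; Prop. 3.1 (b) p. 32; Rem. 5.29 (c) p. 65] -/
theorem RecordSystemGS.mem_of_mk_mul_eq_mk (S : RecordSystemGS L Jstar τ K₀) (Kc N : C5.SmallLevel K₀) (hN : N.1.1 ≤ Kc.1.1)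
    {v : Fin 2 → ℂ} (hv : v ∈ negCone (Jstar.map τ))
    (a k : ↥(finAdelic ↥(maximalRealSubfield L) L (IsCMField.complexConj L) 2 Jstar)) (hk : k ∈ Kc.1.1)
    (h : ShimuraSetGS.mk L Jstar τ N.1.1 v hv (a * k) = ShimuraSetGS.mk L Jstar τ N.1.1 v hv a) : k ∈ N.1.1 := by
  obtain ⟨γ, c, -, hγv, hcoset⟩ := (ShimuraSetGS.mk_eq_mk_iff L Jstar τ N.1.1 v v hv hv (a * k) a).1 h
  rw [MulAction.Quotient.smul_coe, QuotientGroup.eq, smul_eq_mul] at hcoset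
  -- `hcoset : (γ a)⁻¹ (a k) ∈ N`, so `a⁻¹ γ a = ((γ a)⁻¹ (a k) k⁻¹)⁻¹ ∈ Kc`
  have hx : a⁻¹ * rationalToFinAdelic ↥(maximalRealSubfield L) L (IsCMField.complexConj L) 2 Jstar γ * a ∈ Kc.1.1 := by
    have hcalc : a⁻¹ * rationalToFinAdelic ↥(maximalRealSubfield L) L (IsCMField.complexConj L) 2 Jstar γ * a =
        ((rationalToFinAdelic ↥(maximalRealSubfield L) L (IsCMField.complexConj L) 2 Jstar γ * a)⁻¹ * (a * k) * k⁻¹)⁻¹ := by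
      group
    rw [hcalc]
    exact Kc.1.1.inv_mem (Kc.1.1.mul_mem (hN hcoset) (Kc.1.1.inv_mem hk))
  have hγ1 : γ = 1 := S.eq_one_of_conj_mem_of_smul_mulVec_eq Kc γ a hx hv hγv
  rwa [hγ1, map_one, one_mul, inv_mul_cancel_left] at hcoset

/-- The same freeness with the fixed point written as `[v, a k N] = [v, a N]` for `k ∈ Kc` acting on the coset `aN` from the
right and an arbitrary second representative: `[v, b N] = [v, a N]` with `a⁻¹ b ∈ Kc` forces `a⁻¹ b ∈ N`.
[cite: Deligne1979ShimuraVarieties, 2.1.2] [cite: Milne2005ShimuraVarieties, Lemma 5.13 p. 57; Prop. 3.1 (b) p. 32] -/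
theorem RecordSystemGS.inv_mul_mem_of_mk_eq_mk (S : RecordSystemGS L Jstar τ K₀) (Kc N : C5.SmallLevel K₀) (hN : N.1.1 ≤ Kc.1.1)
    {v : Fin 2 → ℂ} (hv : v ∈ negCone (Jstar.map τ))
    (a b : ↥(finAdelic ↥(maximalRealSubfield L) L (IsCMField.complexConj L) 2 Jstar)) (hab : a⁻¹ * b ∈ Kc.1.1)
    (h : ShimuraSetGS.mk L Jstar τ N.1.1 v hv b = ShimuraSetGS.mk L Jstar τ N.1.1 v hv a) : a⁻¹ * b ∈ N.1.1 := by
  refine S.mem_of_mk_mul_eq_mk Kc N hN hv a (a⁻¹ * b) hab ?_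
  rwa [mul_inv_cancel_left]

end UnitaryCanonicalModel

end Literature.AlgebraicGeometry.ShimuraVarieties

end
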